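/-
Literature/AlgebraicGeometry/Pohlmann1968/DegenerateCMTypesAbelianCMFieldMixedDifferencesSubfields.lean — pub-hodgecm2 (COR-CM), KEPT
Literature lane lit-deligne-3 gen 66, file F66a.  THEOREMS ONLY (no `def`, no named fact, no `sorry`, no instance, no notation;
D-0026 net debt 0).  HC_CM is NOT proved.
-/
import Literature.AlgebraicGeometry.Pohlmann1968.DegenerateCMTypesAbelianCMFieldExponentTwiceSquarefree
import Literature.AlgebraicGeometry.Pohlmann1968.DegenerateCMTypesAbelianCMFieldExponentFourSquarefree
import HarnessLib

/-!
# The mixed-difference kernel classes READ ON THE LATTICE OF SUBFIELDS (any number of primes): the dictionary «mixed differences of coset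
# counts at `Gal(K/F)` ⟺ mixed differences of the multiplicities of `Φ|_F`», and the intrinsic rank formulas, nondegeneracy criteria and
# Hodge consequences for abelian CM fields of exponent `2m` and `4m`, `m` odd squarefree; `ℚ(ζ₂₁₁)`, `ℚ(ζ₄₂₁)` on subfields

Topic `Literature/AlgebraicGeometry/Pohlmann1968` (namespace `Literature.AlgebraicGeometry.Pohlmann1968.MixedDifferencesReading`); cell `pub-hodgecm2`
(COR-CM), KEPT Literature lane `lit-deligne-3` gen 66, file F66a — g65 outlook §5 item 1(a): the SUBFIELD DICTIONARY for families of ANY size `|D| ≥ 1`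
(generalising the neighbours' one- and two-prime dictionaries `ExponentTwicePrime.forall_card_filter_eq_iff_level`,
`ExponentTwoOddPrimes.forall_card_filter_add_eq_iff_separable`) and the `…_iff_forall_intermediateField` ∕ `…_ncard_subfields_…` forms of the Gal-level
files F65i (`ExponentTwiceSquarefree`) and F65j (`ExponentFourSquarefree`), whose mixed-difference classes were stated on subgroups of `Gal(K/ℚ)`.
KERNEL ONLY: theorems; no `def`, no named fact, no instance, no notation (D-0014 ∕ D-0026 net debt `0`).  HC_CM is NOT proved here or anywhere in the lane.

## Mathematics

`K` an abelian CM field, `G = Gal(K/ℚ) ∋ ρ` (complex conjugation), `Φ` a CM type, `S = {g : σ_g ∈ Φ}` (`σ_g = φ₀ ∘ g⁻¹`).  For a subfield `F = K^H` the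
coset counts `#(S ∩ gH)` are the MULTIPLICITIES `n(τ) = #{φ ∈ Φ : φ|_F = τ}` of `Φ|_F` at `τ = σ_g|_F` ([Yanai2015IndexDegeneracy] Thm. 4.1, proof),
and `σ_{gx}|_F = σ_g|_F ∘ (x|_F)⁻¹`.  Hence (**`forall_sum_card_filter_eq_zero_iff_mixed`**, any finite index set `ι`, any exponents `e_i`): ALL `|ι|`-TH
MIXED DIFFERENCES of the coset counts vanish at `H = Gal(K/F)` — `Σ_{ε ∈ {0,1}^ι} (−1)^{|ε|} #(S ∩ g·Π_{ε_i=1} x_i·H) = 0` for all `g` and all families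
`x_i ∈ G` with `x_i^{e_i} ∈ H` — iff `Φ` has VANISHING MIXED DIFFERENCES OVER `F`: `Σ_ε (−1)^{|ε|} n(τ ∘ Π_{ε_i=1} σ_i) = 0` for all `τ : F → ℂ` and all
families `σ_i ∈ Gal(F/ℚ)` with `σ_i^{e_i} = 1` (the restriction `G → Gal(F/ℚ)` being onto with kernel `H`).  Consequently the mixed-difference kernels
of index `n` (resp. with cyclic quotient) ARE the CM subfields of degree `n` (resp. with cyclic `Gal(F/ℚ)`) over which `Φ` has vanishing mixed
differences (**`card_index_eq_ncard_mixed`**, **`card_index_isCyclic_eq_ncard_mixed`**, **`forall_subgroup_iff_forall_intermediateField_mixed`**,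
**`forall_subgroup_isCyclic_iff_forall_intermediateField_mixed`**), and the lane's Gal-level rank formulas become INTRINSIC:

* exponent `2m` (`m` odd squarefree, any number of primes; F65g ∕ F65i): `Rank(Φ) + b + Σ_{∅≠D⊆primes(m)} φ(2Π_D q)·s_D = [K:ℚ]/2 + 1`
  (**`cmTypeRank_add_ncard_subfields_eq_of_exponent_two_mul`**), `b` = imaginary quadratic subfields over which `Φ` is of Weil type ([Dodson1984]
  §3.1.1), `s_D` = CM subfields of degree `2Π_D q` over which all `|D|`-th mixed differences of `Φ|_F` vanish (families `σ_q^q = 1`, `q ∈ D`;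
  [Hazama2003CyclicCM] Lemma 4.6.1 mechanism, [LamLeung2000] Thm. 2.2 for the `Π_D q`-relations); NONDEGENERATE ⟺ `b = 0` and all `s_D = 0`
  (**`isNondegenerate_iff_forall_intermediateField_of_exponent_two_mul`**; converse `not_isNondegenerate_of_mixed_of_exponent_two_mul`);
* exponent `4m` (F65h ∕ F65j): `Rank(Φ) + b + 2·e₄ + Σ_{∅≠D} (φ(2Π_D q)·s_{2,D} + φ(4Π_D q)·s_{4,D}) = [K:ℚ]/2 + 1`
  (**`cmTypeRank_add_ncard_subfields_eq_of_exponent_four_mul`**), `e₄` = CM subfields with `Gal(F/ℚ) ≅ ℤ/4` every embedding of which has `[K:F]/2`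
  extensions in `Φ` ([Yanai2015IndexDegeneracy] Thm. 4.1; tree `card_indexFour_eq_ncard_weilQuartic`), `s_{4,D}` with CYCLIC `Gal(F/ℚ)`; criterion
  **`isNondegenerate_iff_forall_intermediateField_of_exponent_four_mul`**.

§4: for every realisation `(A, ι, θ)` of a type off the subfield lists, `B•(Aⁿ) ⊗ ℂ = D•(Aⁿ) ⊗ ℂ` and THE HODGE CONJECTURE FOR ALL POWERS
(**`hodgeConjectureFor_pow_of_forall_intermediateField_of_exponent_two_mul`**, **`…_four_mul`**; Hazama ∕ Pohlmann, tree
`IsNondegenerate.hodgeClassSpan_pow_eq_divisorClassesSpan`) — unconditional.  §5: transfer to `ℚ(ζ_N)` with `u^{2m} = 1` resp. `u^{4m} = 1` on `(ℤ/N)ˣ`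
and the three-prime levels `ℚ(ζ₂₁₁)` (`210 = 2·3·5·7`; subfield degrees `6, 10, 14, 30, 42, 70, 210`) and `ℚ(ζ₄₂₁)` (`420 = 4·3·5·7`) with hypotheses
on SUBFIELDS ONLY (**`hodgeConjectureFor_pow_of_forall_intermediateField_twoHundredEleven`**, **`…_fourHundredTwentyOne`**).

The binder `[IsAbelianGalois ℚ F]` in the subfield-side conditions is AUTOMATIC (every subfield of the abelian `K` is abelian over `ℚ`, Mathlib
`IsAbelianGalois.tower_bot ℚ F K`, which the proofs supply); it appears only because instance search does not find it through the `ℚ`-algebra structure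
of `↥F`, and it provides the commutative product `Π_{ε_q=1} σ_q` in `Gal(F/ℚ)`.  No instance is declared.

PRESEARCH (lane rule): «rank of CM type abelian CM field, mixed differences ∕ vanishing sums of roots of unity of squarefree order, read on subfields» —
corpus hybrid (hits: Green–Griffiths–Kerr pp. 164–166, Lang *Cyclotomic Fields* pp. 64, 198: Kubota rank ∕ nondegenerate types only), galaxy «degenerate CM
type | nondegenerate CM-type | rank of a CM type» (all stars: 1 irrelevant hit) — not in print as such; it is Kubota's Lemma 2 by kernels (White) with the
Dodson ∕ Yanai ∕ Hazama ∕ Lam–Leung class decisions, read through the Galois correspondence; recorded as the lane's own elementary theorem with those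
citations.

HONEST REGISTER.  Unconditional and elementary given the tree (F65g–F65j and the dictionaries).  Nothing is claimed about the Hodge classes of DEGENERATE
types; no census numerics.  The `2`-part of the exponent is `2` resp. `4` exactly; the arbitrary-`2`-part branch is another lane's.  HC_CM is NOT proved and
not used.

## References

* [Kubota1965] T. Kubota, *On the field extension by complex multiplication*, Trans. AMS 118 (1965), §4 Lemma 2.
* [White1993SporadicCycles] S. P. White, *Sporadic cycles on CM abelian varieties*, Compositio Math. 88 (1993), §4 (proof of Lemma 3).
* [Dodson1984] B. Dodson, *The structure of Galois groups of CM-fields*, Trans. AMS 283 (1984), §3.1.1 Theorem.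
* [Hazama2003CyclicCM] F. Hazama, *Hodge cycles on abelian varieties with complex multiplication by cyclic CM-fields*, J. Math. Sci. Univ. Tokyo 10
  (2003): Prop. 4.1, Prop. 4.3, Lemma 4.6.1, Thm. 4.8.
* [LamLeung2000] T. Y. Lam, K. H. Leung, *On vanishing sums of roots of unity*, J. Algebra 224 (2000), Thm. 2.2.
* [Yanai2015IndexDegeneracy] H. Yanai, *On the index of degeneracy of a CM-type*, Thm. 4.1 (proof, p. 818).
* [Gordon1999HodgeAVSurvey] B. B. Gordon, *A survey of the Hodge conjecture for abelian varieties* (1999), Thm. 6.4, §9.3, 9.4.3.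
* [MilneFT2022] J. S. Milne, *Fields and Galois Theory*, Thm. 3.16–3.17 (Galois correspondence).
* [Shimura1998] G. Shimura, *Abelian Varieties with Complex Multiplication and Modular Functions*, §8.1.
* [Washington1997] L. C. Washington, *Introduction to Cyclotomic Fields*, 2nd ed., Ch. 2 Thm. 2.5.
* [Deligne2000] P. Deligne, *The Hodge conjecture* (Clay, 2000), §1.

## Provenance

Cell `pub-hodgecm2` (COR-CM), KEPT Literature lane `lit-deligne-3` gen 66 (claim ABELIAN-SQUAREFREE-SUBFIELD-DICTIONARY; count-neutral, own lane), file F66a;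
neighbours cited by name, nothing restated: `DegenerateCMTypesAbelianCMFieldExponentTwiceSquarefree` (F65i), `…ExponentFourSquarefree` (F65j),
`…CyclicSubfields` (the `H ↔ K^H` dictionary: `card_indexTwo_eq_ncard_weilQuadratic`, `restrictNormalHom_eq_iff`, `card_fibre_restrictNormalHom_eq`,
`isCyclic_quotient_*`), `…CyclicQuarticSubfields` (`card_indexFour_eq_ncard_weilQuartic`, `forall_two_mul_card_filter_eq_iff_forall_fibre`),
`…ExponentFourTimesPrime` (`cm_abelian_pow_eq_one_of_isCyclotomicExtension`).  The `[folklore]` helpers and the two dictionary helpers (copies of F65a's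
private ones) are private.  Theorems only; net Literature debt 0.
-/

noncomputable section

open scoped BigOperators NumberField IsMulCommutative Classical
open NumberField IntermediateField

namespace Literature.AlgebraicGeometry.Pohlmann1968

namespace MixedDifferencesReading

open Literature.NumberTheory.ComplexMultiplication
open Literature.NumberTheory.ComplexMultiplication.CMNumbers
open Literature.AlgebraicGeometry.Motives (CMType)
open Literature.AlgebraicGeometry.Pohlmann1968.CyclicTwoOddPrimes (isCMTypeWith_galType cmTypeRank_eq_typeRank_galType)
open Literature.AlgebraicGeometry.Pohlmann1968.AbelianKernels
open Literature.AlgebraicGeometry.Pohlmann1968.ExponentFourTimesPrime (cm_abelian_pow_eq_one_of_isCyclotomicExtension)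

/-! ## §1 The dictionary for families: mixed differences at `Gal(K/F)` versus mixed differences over `F` -/

section Reading

variable {K : Type} [Field K] [NumberField K] [IsCMField K] [IsAbelianGalois ℚ K]

omit [IsCMField K] [IsAbelianGalois ℚ K] in
/-- `σ_{xg}|_F = σ_g|_F ∘ (x|_F)⁻¹` as embeddings of `F`: `embOf (φ₀|_F) (x̄ ḡ) = (embOf (φ₀|_F) ḡ) ∘ x̄⁻¹`. [cite: Shimura1998, §8.1] -/
private theorem embOf_mul_eq_comp_md (F : IntermediateField ℚ K) (ψ₀ : F →+* ℂ) (σ t : F ≃ₐ[ℚ] F) :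
    embOf ψ₀ (σ * t) = (embOf ψ₀ t).comp (σ.symm : F ≃ₐ[ℚ] F).toRingEquiv.toRingHom := by
  refine RingHom.ext fun y => ?_
  simp only [embOf_apply, RingHom.comp_apply]
  rfl

omit [IsCMField K] in
/-- **The coset counts at `H = Gal(K/F)` are multiplicities of `Φ|_F`**: `#(S ∩ gH) = #{φ ∈ Φ : φ|_F = σ_g|_F}` with
`σ_g|_F = embOf (φ₀|_F) (g|_F)`. [cite: Yanai2015IndexDegeneracy, Thm. 4.1 (proof, p. 818)] -/
private theorem card_filter_inv_mul_mem_eq_md (φ₀ : K →+* ℂ) (Φ : CMType K) (F : IntermediateField ℚ K) [Normal ℚ F]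
    (g : K ≃ₐ[ℚ] K) :
    ((Finset.univ.filter fun g : K ≃ₐ[ℚ] K => embOf φ₀ g ∈ Φ.1).filter fun s => g⁻¹ * s ∈ F.fixingSubgroup).card =
      {φ : K →+* ℂ | φ.comp (algebraMap F K) = embOf (φ₀.comp (algebraMap F K)) (AlgEquiv.restrictNormalHom F g) ∧
        φ ∈ Φ.1}.ncard := by
  have h1 : ((Finset.univ.filter fun g : K ≃ₐ[ℚ] K => embOf φ₀ g ∈ Φ.1).filter
      fun s => g⁻¹ * s ∈ F.fixingSubgroup) =
      ((Finset.univ.filter fun g : K ≃ₐ[ℚ] K => embOf φ₀ g ∈ Φ.1).filter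
        fun s => AlgEquiv.restrictNormalHom F s = AlgEquiv.restrictNormalHom F g) :=
    Finset.filter_congr fun s _ => (restrictNormalHom_eq_iff F s g).symm
  rw [h1, card_fibre_restrictNormalHom_eq φ₀ Φ F, ← Set.ncard_coe_finset]
  congr 1
  ext φ
  simp only [Finset.coe_filter, Finset.mem_univ, true_and, Set.mem_setOf_eq]
  tauto

omit [IsCMField K] in
/-- The coset count at `g·P·H` (`H = Gal(K/F)`) is the multiplicity of `Φ|_F` at `σ_g|_F ∘ (P|_F)⁻¹`. [cite: Yanai2015IndexDegeneracy, Thm. 4.1 (proof, p. 818)] -/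
private theorem card_filter_mul_inv_mul_mem_eq_md (φ₀ : K →+* ℂ) (Φ : CMType K) (F : IntermediateField ℚ K) [Normal ℚ F]
    (g P : K ≃ₐ[ℚ] K) :
    ((Finset.univ.filter fun g : K ≃ₐ[ℚ] K => embOf φ₀ g ∈ Φ.1).filter fun s => (g * P)⁻¹ * s ∈ F.fixingSubgroup).card =
      {φ : K →+* ℂ | φ.comp (algebraMap F K) =
        (embOf (φ₀.comp (algebraMap F K)) (AlgEquiv.restrictNormalHom F g)).comp
          ((AlgEquiv.restrictNormalHom F P).symm : F ≃ₐ[ℚ] F).toRingEquiv.toRingHom ∧ φ ∈ Φ.1}.ncard := by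
  rw [mul_comm g P, card_filter_inv_mul_mem_eq_md φ₀ Φ F (P * g), map_mul, embOf_mul_eq_comp_md]

omit [IsCMField K] in
/-- Restriction to `F` of a signed product of a family: `((Π_{ε_i} x_i)|_F)⁻¹ = Π_{ε_i} (x_i|_F)⁻¹`. [cite: MilneFT2022, Thm. 3.17] -/
private theorem symm_restrictNormalHom_prod_ite_md (F : IntermediateField ℚ K) [Normal ℚ F] [IsAbelianGalois ℚ F]
    {ι : Type} [Fintype ι] (x : ι → (K ≃ₐ[ℚ] K)) (ε : ι → Bool) :
    ((AlgEquiv.restrictNormalHom F (∏ i, (if ε i then x i else 1)) : F ≃ₐ[ℚ] F).symm : F ≃ₐ[ℚ] F) =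
      ∏ i, (if ε i then (AlgEquiv.restrictNormalHom F (x i))⁻¹ else 1) := by
  rw [← AlgEquiv.aut_inv, map_prod, ← Finset.prod_inv_distrib]
  refine Finset.prod_congr rfl fun i _ => ?_
  by_cases h : ε i
  · simp only [h, ↓reduceIte]
  · simp only [h, Bool.false_eq_true, ↓reduceIte, map_one, inv_one]

omit [IsCMField K] in
/-- **MIXED DIFFERENCES AT `Gal(K/F)` READ ON `F` (any family of exponents).**  For a subfield `F ⊆ K`, a finite index set `ι` and exponents
`e : ι → ℕ`, the following are equivalent: (a) at `H = Gal(K/F)` all the `|ι|`-th mixed differences of the coset counts of the type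
`S ⊆ Gal(K/ℚ)` vanish — `Σ_{ε ∈ {0,1}^ι} (−1)^{|ε|} #(S ∩ g·Π_{ε_i = 1} x_i·H) = 0` for every base point `g` and every family `x : ι → Gal(K/ℚ)`
with `x_i^{e_i} ∈ H`; (b) `Φ` has VANISHING MIXED DIFFERENCES OVER `F` (of exponents `e`): for every family `σ : ι → Gal(F/ℚ)` with
`σ_i^{e_i} = 1` and every embedding `τ : F → ℂ`, `Σ_{ε} (−1)^{|ε|} n(τ ∘ Π_{ε_i = 1} σ_i) = 0`, `n(τ') = #{φ ∈ Φ : φ|_F = τ'}` the multiplicities of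
`Φ|_F`.  (`|ι| = 1`: levelness, the neighbour's `ExponentTwicePrime.forall_card_filter_eq_iff_level`; `|ι| = 2`: additive separability,
`ExponentTwoOddPrimes.forall_card_filter_add_eq_iff_separable`.)  The instance hypothesis `[IsAbelianGalois ℚ F]` is automatic (every subfield of
the abelian `K` is abelian over `ℚ`, Mathlib `IsAbelianGalois.tower_bot ℚ F K`); it is a binder only because instance search does not find it through
the `ℚ`-algebra structure of `↥F`, and it supplies the (commutative) product on `Gal(F/ℚ)`. [cite: Yanai2015IndexDegeneracy, Thm. 4.1 (proof, p. 818)]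
[cite: Hazama2003CyclicCM, Prop. 4.1, Lemma 4.6.1 and Thm. 4.8] [cite: LamLeung2000, Thm. 2.2] -/
theorem forall_sum_card_filter_eq_zero_iff_mixed (φ₀ : K →+* ℂ) (Φ : CMType K) (F : IntermediateField ℚ K) [IsAbelianGalois ℚ F]
    {ι : Type} [Fintype ι] [DecidableEq ι] (e : ι → ℕ) :
    (∀ (g : K ≃ₐ[ℚ] K) (x : ι → (K ≃ₐ[ℚ] K)), (∀ i, x i ^ e i ∈ F.fixingSubgroup) →
        ∑ ε : ι → Bool, (∏ i, (if ε i then (-1 : ℤ) else 1)) *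
          (((Finset.univ.filter fun g : K ≃ₐ[ℚ] K => embOf φ₀ g ∈ Φ.1).filter
            fun s => (g * ∏ i, (if ε i then x i else 1))⁻¹ * s ∈ F.fixingSubgroup).card : ℤ) = 0) ↔
      ∀ σ : ι → (F ≃ₐ[ℚ] F), (∀ i, σ i ^ e i = 1) → ∀ τ : F →+* ℂ,
        ∑ ε : ι → Bool, (∏ i, (if ε i then (-1 : ℤ) else 1)) *
          ({φ : K →+* ℂ | φ.comp (algebraMap F K) = τ.comp (∏ i, (if ε i then σ i else 1)).toRingEquiv.toRingHom ∧
            φ ∈ Φ.1}.ncard : ℤ) = 0 := by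
  haveI := normal_of_isAbelianGalois F
  set ψ₀ : F →+* ℂ := φ₀.comp (algebraMap F K) with hψ₀
  have hres1 : ∀ (x : K ≃ₐ[ℚ] K) (n : ℕ), x ^ n ∈ F.fixingSubgroup ↔ (AlgEquiv.restrictNormalHom F x) ^ n = 1 :=
    fun x n => by rw [← map_pow, restrictNormalHom_eq_one_iff]
  -- the coset counts along a signed product, as multiplicities of `Φ|_F`
  have hcount : ∀ (g : K ≃ₐ[ℚ] K) (x : ι → (K ≃ₐ[ℚ] K)) (ε : ι → Bool),
      (((Finset.univ.filter fun g : K ≃ₐ[ℚ] K => embOf φ₀ g ∈ Φ.1).filter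
          fun s => (g * ∏ i, (if ε i then x i else 1))⁻¹ * s ∈ F.fixingSubgroup).card : ℤ) =
        ({φ : K →+* ℂ | φ.comp (algebraMap F K) =
            (embOf ψ₀ (AlgEquiv.restrictNormalHom F g)).comp
              (∏ i, (if ε i then (AlgEquiv.restrictNormalHom F (x i))⁻¹ else 1)).toRingEquiv.toRingHom ∧
          φ ∈ Φ.1}.ncard : ℤ) := by
    intro g x ε
    rw [card_filter_mul_inv_mul_mem_eq_md φ₀ Φ F g, symm_restrictNormalHom_prod_ite_md F x ε]
  constructor
  · intro h σ hσ τ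
    obtain ⟨t, rfl⟩ := (embOf_bijective ψ₀).2 τ
    obtain ⟨g, rfl⟩ := AlgEquiv.restrictNormalHom_surjective K t
    have hx : ∀ i, ∃ x : K ≃ₐ[ℚ] K, AlgEquiv.restrictNormalHom F x = (σ i)⁻¹ :=
      fun i => AlgEquiv.restrictNormalHom_surjective K (σ i)⁻¹
    choose x hx using hx
    have hxe : ∀ i, x i ^ e i ∈ F.fixingSubgroup := fun i => by rw [hres1, hx, inv_pow, hσ, inv_one]
    have key := h g x hxe
    rw [← key]
    refine Finset.sum_congr rfl fun ε _ => ?_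
    have hprod : (∏ i, (if ε i then (AlgEquiv.restrictNormalHom F (x i))⁻¹ else 1) : F ≃ₐ[ℚ] F) =
        ∏ i, (if ε i then σ i else 1) :=
      Finset.prod_congr rfl fun i _ => by rw [hx, inv_inv]
    rw [hcount g x ε, hprod]
  · intro h g x hx
    have key := h (fun i => (AlgEquiv.restrictNormalHom F (x i))⁻¹)
      (fun i => by rw [inv_pow, inv_eq_one, ← hres1]; exact hx i) (embOf ψ₀ (AlgEquiv.restrictNormalHom F g))
    rw [← key]
    exact Finset.sum_congr rfl fun ε _ => by rw [hcount g x ε]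

/-- **The mixed-difference kernels of index `n` ARE the CM subfields of degree `n` over which `Φ` has vanishing mixed differences** (any family of
exponents `e : ι → ℕ`): `H ↦ K^H` is a bijection from the subgroups `H ∌ ρ` of `Gal(K/ℚ)` of index `n` at which all `|ι|`-th mixed differences of the
coset counts of `S` (over families `x_i` with `x_i^{e_i} ∈ H`) vanish onto the subfields `F ⊆ K` with `[F:ℚ] = n`, `F` not totally real (a CM
subfield), over which `Φ` has vanishing mixed differences of exponents `e` (the binder `[IsAbelianGalois ℚ F]` is automatic, see
`forall_sum_card_filter_eq_zero_iff_mixed`). [cite: Yanai2015IndexDegeneracy, Thm. 4.1 (proof, p. 818)] [cite: MilneFT2022, Thm. 3.16] -/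
theorem card_index_eq_ncard_mixed (φ₀ : K →+* ℂ) (Φ : CMType K) {ι : Type} [Fintype ι] [DecidableEq ι] (e : ι → ℕ) (n : ℕ) :
    ((Finset.univ : Finset (Subgroup (K ≃ₐ[ℚ] K))).filter fun H => (conjGal : K ≃ₐ[ℚ] K) ∉ H ∧ H.index = n ∧
        ∀ (g : K ≃ₐ[ℚ] K) (x : ι → (K ≃ₐ[ℚ] K)), (∀ i, x i ^ e i ∈ H) →
          ∑ ε : ι → Bool, (∏ i, (if ε i then (-1 : ℤ) else 1)) *
            (((Finset.univ.filter fun g : K ≃ₐ[ℚ] K => embOf φ₀ g ∈ Φ.1).filter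
              fun s => (g * ∏ i, (if ε i then x i else 1))⁻¹ * s ∈ H).card : ℤ) = 0).card =
      {F : IntermediateField ℚ K | Module.finrank ℚ F = n ∧ ¬ IsTotallyReal F ∧
        ∀ [IsAbelianGalois ℚ F] (σ : ι → (F ≃ₐ[ℚ] F)), (∀ i, σ i ^ e i = 1) → ∀ τ : F →+* ℂ,
          ∑ ε : ι → Bool, (∏ i, (if ε i then (-1 : ℤ) else 1)) *
            ({φ : K →+* ℂ | φ.comp (algebraMap F K) = τ.comp (∏ i, (if ε i then σ i else 1)).toRingEquiv.toRingHom ∧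
              φ ∈ Φ.1}.ncard : ℤ) = 0}.ncard := by
  set B := ((Finset.univ : Finset (Subgroup (K ≃ₐ[ℚ] K))).filter fun H => (conjGal : K ≃ₐ[ℚ] K) ∉ H ∧ H.index = n ∧
        ∀ (g : K ≃ₐ[ℚ] K) (x : ι → (K ≃ₐ[ℚ] K)), (∀ i, x i ^ e i ∈ H) →
          ∑ ε : ι → Bool, (∏ i, (if ε i then (-1 : ℤ) else 1)) *
            (((Finset.univ.filter fun g : K ≃ₐ[ℚ] K => embOf φ₀ g ∈ Φ.1).filter
              fun s => (g * ∏ i, (if ε i then x i else 1))⁻¹ * s ∈ H).card : ℤ) = 0) with hB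
  have hinj : Function.Injective (fun H : Subgroup (K ≃ₐ[ℚ] K) => fixedField H) := fun H H' hHH' => by
    have := congrArg IntermediateField.fixingSubgroup hHH'
    simpa only [fixingSubgroup_fixedField] using this
  have himage : (fun H : Subgroup (K ≃ₐ[ℚ] K) => fixedField H) '' (↑B : Set (Subgroup (K ≃ₐ[ℚ] K))) =
      {F : IntermediateField ℚ K | Module.finrank ℚ F = n ∧ ¬ IsTotallyReal F ∧
        ∀ [IsAbelianGalois ℚ F] (σ : ι → (F ≃ₐ[ℚ] F)), (∀ i, σ i ^ e i = 1) → ∀ τ : F →+* ℂ,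
          ∑ ε : ι → Bool, (∏ i, (if ε i then (-1 : ℤ) else 1)) *
            ({φ : K →+* ℂ | φ.comp (algebraMap F K) = τ.comp (∏ i, (if ε i then σ i else 1)).toRingEquiv.toRingHom ∧
              φ ∈ Φ.1}.ncard : ℤ) = 0} := by
    ext F
    simp only [Set.mem_image, Finset.mem_coe, hB, Finset.mem_filter, Finset.mem_univ, true_and,
      Set.mem_setOf_eq]
    constructor
    · rintro ⟨H, ⟨hρH, hidx, hS⟩, rfl⟩
      refine ⟨by rw [← index_eq_finrank_fixedField, hidx],
        (conjGal_not_mem_iff_not_isTotallyReal_fixedField H).1 hρH, fun {_} => ?_⟩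
      refine (forall_sum_card_filter_eq_zero_iff_mixed φ₀ Φ (fixedField H) e).1 ?_
      simpa only [fixingSubgroup_fixedField] using hS
    · rintro ⟨hn, hF, hS⟩
      haveI : IsAbelianGalois ℚ F := IsAbelianGalois.tower_bot ℚ F K
      refine ⟨F.fixingSubgroup, ⟨(conjGal_not_mem_fixingSubgroup_iff F).2 hF,
        by rw [CMNumbers.index_fixingSubgroup_eq_finrank, hn], (forall_sum_card_filter_eq_zero_iff_mixed φ₀ Φ F e).2 hS⟩,
        IsGalois.fixedField_fixingSubgroup F⟩
  rw [← himage, Set.ncard_image_of_injective _ hinj, Set.ncard_coe_finset]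

/-- **The same with CYCLIC quotient** (the index-`4Π_D q` classes of exponent `4m`): the mixed-difference kernels `H ∌ ρ` of index `n` with
`Gal(K/ℚ)/H` cyclic ARE the CM subfields `F` of degree `n` with `Gal(F/ℚ)` cyclic over which `Φ` has vanishing mixed differences.
[cite: Yanai2015IndexDegeneracy, Thm. 4.1 (proof, p. 818)] [cite: MilneFT2022, Thm. 3.16–3.17] -/
theorem card_index_isCyclic_eq_ncard_mixed (φ₀ : K →+* ℂ) (Φ : CMType K) {ι : Type} [Fintype ι] [DecidableEq ι] (e : ι → ℕ) (n : ℕ) :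
    ((Finset.univ : Finset (Subgroup (K ≃ₐ[ℚ] K))).filter fun H => (conjGal : K ≃ₐ[ℚ] K) ∉ H ∧ H.index = n ∧
        IsCyclic ((K ≃ₐ[ℚ] K) ⧸ H) ∧
        ∀ (g : K ≃ₐ[ℚ] K) (x : ι → (K ≃ₐ[ℚ] K)), (∀ i, x i ^ e i ∈ H) →
          ∑ ε : ι → Bool, (∏ i, (if ε i then (-1 : ℤ) else 1)) *
            (((Finset.univ.filter fun g : K ≃ₐ[ℚ] K => embOf φ₀ g ∈ Φ.1).filter
              fun s => (g * ∏ i, (if ε i then x i else 1))⁻¹ * s ∈ H).card : ℤ) = 0).card =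
      {F : IntermediateField ℚ K | Module.finrank ℚ F = n ∧ ¬ IsTotallyReal F ∧ IsCyclic (F ≃ₐ[ℚ] F) ∧
        ∀ [IsAbelianGalois ℚ F] (σ : ι → (F ≃ₐ[ℚ] F)), (∀ i, σ i ^ e i = 1) → ∀ τ : F →+* ℂ,
          ∑ ε : ι → Bool, (∏ i, (if ε i then (-1 : ℤ) else 1)) *
            ({φ : K →+* ℂ | φ.comp (algebraMap F K) = τ.comp (∏ i, (if ε i then σ i else 1)).toRingEquiv.toRingHom ∧
              φ ∈ Φ.1}.ncard : ℤ) = 0}.ncard := by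
  set B := ((Finset.univ : Finset (Subgroup (K ≃ₐ[ℚ] K))).filter fun H => (conjGal : K ≃ₐ[ℚ] K) ∉ H ∧ H.index = n ∧
        IsCyclic ((K ≃ₐ[ℚ] K) ⧸ H) ∧
        ∀ (g : K ≃ₐ[ℚ] K) (x : ι → (K ≃ₐ[ℚ] K)), (∀ i, x i ^ e i ∈ H) →
          ∑ ε : ι → Bool, (∏ i, (if ε i then (-1 : ℤ) else 1)) *
            (((Finset.univ.filter fun g : K ≃ₐ[ℚ] K => embOf φ₀ g ∈ Φ.1).filter
              fun s => (g * ∏ i, (if ε i then x i else 1))⁻¹ * s ∈ H).card : ℤ) = 0) with hB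
  have hinj : Function.Injective (fun H : Subgroup (K ≃ₐ[ℚ] K) => fixedField H) := fun H H' hHH' => by
    have := congrArg IntermediateField.fixingSubgroup hHH'
    simpa only [fixingSubgroup_fixedField] using this
  have himage : (fun H : Subgroup (K ≃ₐ[ℚ] K) => fixedField H) '' (↑B : Set (Subgroup (K ≃ₐ[ℚ] K))) =
      {F : IntermediateField ℚ K | Module.finrank ℚ F = n ∧ ¬ IsTotallyReal F ∧ IsCyclic (F ≃ₐ[ℚ] F) ∧
        ∀ [IsAbelianGalois ℚ F] (σ : ι → (F ≃ₐ[ℚ] F)), (∀ i, σ i ^ e i = 1) → ∀ τ : F →+* ℂ,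
          ∑ ε : ι → Bool, (∏ i, (if ε i then (-1 : ℤ) else 1)) *
            ({φ : K →+* ℂ | φ.comp (algebraMap F K) = τ.comp (∏ i, (if ε i then σ i else 1)).toRingEquiv.toRingHom ∧
              φ ∈ Φ.1}.ncard : ℤ) = 0} := by
    ext F
    simp only [Set.mem_image, Finset.mem_coe, hB, Finset.mem_filter, Finset.mem_univ, true_and,
      Set.mem_setOf_eq]
    constructor
    · rintro ⟨H, ⟨hρH, hidx, hcyc, hS⟩, rfl⟩
      refine ⟨by rw [← index_eq_finrank_fixedField, hidx],
        (conjGal_not_mem_iff_not_isTotallyReal_fixedField H).1 hρH,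
        (isCyclic_quotient_iff_isCyclic_gal_fixedField H).1 hcyc, fun {_} => ?_⟩
      refine (forall_sum_card_filter_eq_zero_iff_mixed φ₀ Φ (fixedField H) e).1 ?_
      simpa only [fixingSubgroup_fixedField] using hS
    · rintro ⟨hn, hF, hcyc, hS⟩
      haveI : IsAbelianGalois ℚ F := IsAbelianGalois.tower_bot ℚ F K
      refine ⟨F.fixingSubgroup, ⟨(conjGal_not_mem_fixingSubgroup_iff F).2 hF,
        by rw [CMNumbers.index_fixingSubgroup_eq_finrank, hn], (isCyclic_quotient_fixingSubgroup_iff F).2 hcyc,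
        (forall_sum_card_filter_eq_zero_iff_mixed φ₀ Φ F e).2 hS⟩, IsGalois.fixedField_fixingSubgroup F⟩
  rw [← himage, Set.ncard_image_of_injective _ hinj, Set.ncard_coe_finset]

/-- **«At NO kernel of index `n`» ⟺ «over NO CM subfield of degree `n`»** (the criterion clauses): all `|ι|`-th mixed differences of the coset counts
vanish at no subgroup `H ∌ ρ` of index `n` iff `Φ` has vanishing mixed differences (of exponents `e`) over no CM subfield of degree `n`.
[cite: Yanai2015IndexDegeneracy, Thm. 4.1 (proof, p. 818)] [cite: MilneFT2022, Thm. 3.16] -/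
theorem forall_subgroup_iff_forall_intermediateField_mixed (φ₀ : K →+* ℂ) (Φ : CMType K) {ι : Type} [Fintype ι] [DecidableEq ι]
    (e : ι → ℕ) (n : ℕ) :
    (∀ H : Subgroup (K ≃ₐ[ℚ] K), (conjGal : K ≃ₐ[ℚ] K) ∉ H → H.index = n →
        ¬ ∀ (g : K ≃ₐ[ℚ] K) (x : ι → (K ≃ₐ[ℚ] K)), (∀ i, x i ^ e i ∈ H) →
          ∑ ε : ι → Bool, (∏ i, (if ε i then (-1 : ℤ) else 1)) *
            (((Finset.univ.filter fun g : K ≃ₐ[ℚ] K => embOf φ₀ g ∈ Φ.1).filter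
              fun s => (g * ∏ i, (if ε i then x i else 1))⁻¹ * s ∈ H).card : ℤ) = 0) ↔
      ∀ F : IntermediateField ℚ K, Module.finrank ℚ F = n → ¬ IsTotallyReal F → ∀ [IsAbelianGalois ℚ F],
        ¬ ∀ σ : ι → (F ≃ₐ[ℚ] F), (∀ i, σ i ^ e i = 1) → ∀ τ : F →+* ℂ,
          ∑ ε : ι → Bool, (∏ i, (if ε i then (-1 : ℤ) else 1)) *
            ({φ : K →+* ℂ | φ.comp (algebraMap F K) = τ.comp (∏ i, (if ε i then σ i else 1)).toRingEquiv.toRingHom ∧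
              φ ∈ Φ.1}.ncard : ℤ) = 0 := by
  constructor
  · intro h F hn hF _ hS
    exact h F.fixingSubgroup ((conjGal_not_mem_fixingSubgroup_iff F).2 hF)
      (by rw [CMNumbers.index_fixingSubgroup_eq_finrank, hn]) ((forall_sum_card_filter_eq_zero_iff_mixed φ₀ Φ F e).2 hS)
  · intro h H hρH hidx hS
    haveI : IsAbelianGalois ℚ (fixedField H) := IsAbelianGalois.tower_bot ℚ (fixedField H) K
    refine h (fixedField H) (by rw [← index_eq_finrank_fixedField, hidx])
      ((conjGal_not_mem_iff_not_isTotallyReal_fixedField H).1 hρH)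
      ((forall_sum_card_filter_eq_zero_iff_mixed φ₀ Φ (fixedField H) e).1 ?_)
    simpa only [fixingSubgroup_fixedField] using hS

/-- **The same with cyclic quotient ⟺ cyclic `Gal(F/ℚ)`** (the index-`4Π_D q` criterion clauses). [cite: Yanai2015IndexDegeneracy, Thm. 4.1 (proof, p. 818)]
[cite: MilneFT2022, Thm. 3.16–3.17] -/
theorem forall_subgroup_isCyclic_iff_forall_intermediateField_mixed (φ₀ : K →+* ℂ) (Φ : CMType K) {ι : Type} [Fintype ι] [DecidableEq ι]
    (e : ι → ℕ) (n : ℕ) :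
    (∀ H : Subgroup (K ≃ₐ[ℚ] K), (conjGal : K ≃ₐ[ℚ] K) ∉ H → H.index = n → IsCyclic ((K ≃ₐ[ℚ] K) ⧸ H) →
        ¬ ∀ (g : K ≃ₐ[ℚ] K) (x : ι → (K ≃ₐ[ℚ] K)), (∀ i, x i ^ e i ∈ H) →
          ∑ ε : ι → Bool, (∏ i, (if ε i then (-1 : ℤ) else 1)) *
            (((Finset.univ.filter fun g : K ≃ₐ[ℚ] K => embOf φ₀ g ∈ Φ.1).filter
              fun s => (g * ∏ i, (if ε i then x i else 1))⁻¹ * s ∈ H).card : ℤ) = 0) ↔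
      ∀ F : IntermediateField ℚ K, Module.finrank ℚ F = n → ¬ IsTotallyReal F → IsCyclic (F ≃ₐ[ℚ] F) → ∀ [IsAbelianGalois ℚ F],
        ¬ ∀ σ : ι → (F ≃ₐ[ℚ] F), (∀ i, σ i ^ e i = 1) → ∀ τ : F →+* ℂ,
          ∑ ε : ι → Bool, (∏ i, (if ε i then (-1 : ℤ) else 1)) *
            ({φ : K →+* ℂ | φ.comp (algebraMap F K) = τ.comp (∏ i, (if ε i then σ i else 1)).toRingEquiv.toRingHom ∧
              φ ∈ Φ.1}.ncard : ℤ) = 0 := by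
  constructor
  · intro h F hn hF hcyc _ hS
    exact h F.fixingSubgroup ((conjGal_not_mem_fixingSubgroup_iff F).2 hF)
      (by rw [CMNumbers.index_fixingSubgroup_eq_finrank, hn]) ((isCyclic_quotient_fixingSubgroup_iff F).2 hcyc)
      ((forall_sum_card_filter_eq_zero_iff_mixed φ₀ Φ F e).2 hS)
  · intro h H hρH hidx hcyc hS
    haveI : IsAbelianGalois ℚ (fixedField H) := IsAbelianGalois.tower_bot ℚ (fixedField H) K
    refine h (fixedField H) (by rw [← index_eq_finrank_fixedField, hidx])
      ((conjGal_not_mem_iff_not_isTotallyReal_fixedField H).1 hρH) ((isCyclic_quotient_iff_isCyclic_gal_fixedField H).1 hcyc)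
      ((forall_sum_card_filter_eq_zero_iff_mixed φ₀ Φ (fixedField H) e).1 ?_)
    simpa only [fixingSubgroup_fixedField] using hS

end Reading

/-! ## §2 Exponent `2m`, `m` odd squarefree: the rank formula and the nondegeneracy criterion ON THE LATTICE OF SUBFIELDS -/

section TwoMul

variable {K : Type} [Field K] [NumberField K] [IsCMField K] [IsAbelianGalois ℚ K] {m : ℕ}

/-- **THE RANK OF A CM TYPE OF AN ABELIAN CM FIELD OF EXPONENT `2m` (`m` ODD SQUAREFREE), ON THE LATTICE OF SUBFIELDS.**  Let `K` be a CM field,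
abelian over `ℚ`, with `g^{2m} = 1` on `Gal(K/ℚ)`, and `Φ` ANY CM type of `K`.  Then

  `Rank(Φ) + b(Φ) + Σ_{∅ ≠ D ⊆ primes(m)} φ(2Π_{q∈D} q) · s_D(Φ) = [K:ℚ]/2 + 1`,

where `b(Φ)` = the imaginary quadratic subfields over which `Φ` is of Weil type and `s_D(Φ)` = the CM subfields `F ⊆ K` of degree `2Π_{q∈D} q` over which
`Φ` has VANISHING `|D|`-TH MIXED DIFFERENCES: for every family `σ_q ∈ Gal(F/ℚ)` (`q ∈ D`) with `σ_q^q = 1` and every `τ : F → ℂ`,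
`Σ_{ε ∈ {0,1}^D} (−1)^{|ε|} #{φ ∈ Φ : φ|_F = τ ∘ Π_{ε_q = 1} σ_q} = 0` (for `D = {p}`: `Φ` level of exponent `p` over `F`; for `D = {p, q}`: additively
separable — the tree's `ExponentTwicePrime`, `ExponentTwoOddPrimes`).  Kubota's defect regrouped by kernels (White), each class decided (Dodson; Hazama;
the `Πq`-relations of Lam–Leung), read through the Galois correspondence (Yanai). [cite: Kubota1965, §4 Lemma 2] [cite: Hazama2003CyclicCM, Prop. 4.3 and Thm. 4.8]
[cite: Dodson1984, §3.1.1 Theorem] [cite: LamLeung2000, Thm. 2.2] [cite: Yanai2015IndexDegeneracy, Thm. 4.1 (proof, p. 818)] -/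
theorem cmTypeRank_add_ncard_subfields_eq_of_exponent_two_mul (hm : Squarefree m) (hodd : ¬ 2 ∣ m)
    (hexp : ∀ g : K ≃ₐ[ℚ] K, g ^ (2 * m) = 1) (Φ : CMType K) :
    cmTypeRank Φ + {F : IntermediateField ℚ K | Module.finrank ℚ F = 2 ∧ ¬ IsTotallyReal F ∧
        ∀ τ : F →+* ℂ, {φ : K →+* ℂ | φ.comp (algebraMap F K) = τ ∧ φ ∈ Φ.1}.ncard =
          {φ : K →+* ℂ | φ.comp (algebraMap F K) = τ ∧ φ ∉ Φ.1}.ncard}.ncard +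
      ∑ D ∈ m.primeFactors.powerset.filter (fun D => D.Nonempty),
        (2 * ∏ q ∈ D, q).totient *
          {F : IntermediateField ℚ K | Module.finrank ℚ F = 2 * ∏ q ∈ D, q ∧ ¬ IsTotallyReal F ∧
            ∀ [IsAbelianGalois ℚ F] (σ : D → (F ≃ₐ[ℚ] F)), (∀ q : D, σ q ^ (q : ℕ) = 1) → ∀ τ : F →+* ℂ,
              ∑ ε : D → Bool, (∏ q, (if ε q then (-1 : ℤ) else 1)) *
                ({φ : K →+* ℂ | φ.comp (algebraMap F K) = τ.comp (∏ q, (if ε q then σ q else 1)).toRingEquiv.toRingHom ∧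
                  φ ∈ Φ.1}.ncard : ℤ) = 0}.ncard = Module.finrank ℚ K / 2 + 1 := by
  obtain ⟨φ₀⟩ := (inferInstance : Nonempty (K →+* ℂ))
  rw [← card_indexTwo_eq_ncard_weilQuadratic φ₀ Φ, ← ExponentTwiceSquarefree.cmTypeRank_add_card_add_sum_totient_mul_card_eq hm hodd φ₀ hexp Φ]
  congr 1
  refine Finset.sum_congr rfl fun D _ => ?_
  rw [card_index_eq_ncard_mixed φ₀ Φ (fun q : D => (q : ℕ)) (2 * ∏ q ∈ D, q)]

/-- **NONDEGENERACY CRITERION ON THE LATTICE OF SUBFIELDS (exponent `2m`, `m` odd squarefree).**  `Φ` is NONDEGENERATE iff (i) it is of Weil type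
over NO imaginary quadratic subfield and (ii) for every nonempty set `D` of prime divisors of `m`, over NO CM subfield `F` of degree `2Π_{q∈D} q` do all
the `|D|`-th mixed differences of the multiplicities of `Φ|_F` vanish — an intrinsic statement (no base embedding, no Galois bookkeeping).
[cite: Kubota1965, §4 Lemma 2] [cite: Hazama2003CyclicCM, Prop. 4.3 and Thm. 4.8] [cite: Dodson1984, §3.1.1 Theorem] [cite: Yanai2015IndexDegeneracy, Thm. 4.1] -/
theorem isNondegenerate_iff_forall_intermediateField_of_exponent_two_mul (hm : Squarefree m) (hodd : ¬ 2 ∣ m)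
    (hexp : ∀ g : K ≃ₐ[ℚ] K, g ^ (2 * m) = 1) (Φ : CMType K) :
    IsNondegenerate Φ ↔
      (∀ F : IntermediateField ℚ K, Module.finrank ℚ F = 2 → ¬ IsTotallyReal F →
        ¬ ∀ τ : F →+* ℂ, {φ : K →+* ℂ | φ.comp (algebraMap F K) = τ ∧ φ ∈ Φ.1}.ncard =
          {φ : K →+* ℂ | φ.comp (algebraMap F K) = τ ∧ φ ∉ Φ.1}.ncard) ∧
      ∀ D ∈ m.primeFactors.powerset, D.Nonempty → ∀ F : IntermediateField ℚ K, Module.finrank ℚ F = 2 * ∏ q ∈ D, q →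
        ¬ IsTotallyReal F → ∀ [IsAbelianGalois ℚ F],
        ¬ ∀ σ : D → (F ≃ₐ[ℚ] F), (∀ q : D, σ q ^ (q : ℕ) = 1) → ∀ τ : F →+* ℂ,
          ∑ ε : D → Bool, (∏ q, (if ε q then (-1 : ℤ) else 1)) *
            ({φ : K →+* ℂ | φ.comp (algebraMap F K) = τ.comp (∏ q, (if ε q then σ q else 1)).toRingEquiv.toRingHom ∧
              φ ∈ Φ.1}.ncard : ℤ) = 0 := by
  obtain ⟨φ₀⟩ := (inferInstance : Nonempty (K →+* ℂ))
  rw [ExponentTwiceSquarefree.isNondegenerate_iff hm hodd φ₀ hexp Φ]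
  refine and_congr_right fun _ => forall_congr' fun D => forall_congr' fun _ => forall_congr' fun _ => ?_
  exact forall_subgroup_iff_forall_intermediateField_mixed φ₀ Φ (fun q : D => (q : ℕ)) (2 * ∏ q ∈ D, q)

/-- **Conversely: a CM subfield of degree `2Π_{q∈D} q` (`∅ ≠ D ⊆ primes(m)`) over which all `|D|`-th mixed differences of `Φ|_F` vanish makes the type
DEGENERATE** (it costs `φ(2Π_D q)` in rank). [cite: Kubota1965, §4 Lemma 2] [cite: Hazama2003CyclicCM, Thm. 4.8] -/
theorem not_isNondegenerate_of_mixed_of_exponent_two_mul (hm : Squarefree m) (hodd : ¬ 2 ∣ m)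
    (hexp : ∀ g : K ≃ₐ[ℚ] K, g ^ (2 * m) = 1) (Φ : CMType K) {D : Finset ℕ} (hD : D ∈ m.primeFactors.powerset)
    (hne : D.Nonempty) (F : IntermediateField ℚ K) [IsAbelianGalois ℚ F] (hdeg : Module.finrank ℚ F = 2 * ∏ q ∈ D, q) (hF : ¬ IsTotallyReal F)
    (hS : ∀ σ : D → (F ≃ₐ[ℚ] F), (∀ q : D, σ q ^ (q : ℕ) = 1) → ∀ τ : F →+* ℂ,
          ∑ ε : D → Bool, (∏ q, (if ε q then (-1 : ℤ) else 1)) *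
            ({φ : K →+* ℂ | φ.comp (algebraMap F K) = τ.comp (∏ q, (if ε q then σ q else 1)).toRingEquiv.toRingHom ∧
              φ ∈ Φ.1}.ncard : ℤ) = 0) :
    ¬ IsNondegenerate Φ := by
  rw [isNondegenerate_iff_forall_intermediateField_of_exponent_two_mul hm hodd hexp Φ]
  exact fun h => h.2 D hD hne F hdeg hF hS

end TwoMul

/-! ## §3 Exponent `4m`, `m` odd squarefree: the rank formula and the nondegeneracy criterion ON THE LATTICE OF SUBFIELDS -/

section FourMul

variable {K : Type} [Field K] [NumberField K] [IsCMField K] [IsAbelianGalois ℚ K] {m : ℕ}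

/-- **THE RANK OF A CM TYPE OF AN ABELIAN CM FIELD OF EXPONENT `4m` (`m` ODD SQUAREFREE), ON THE LATTICE OF SUBFIELDS.**  Let `K` be a CM field, abelian
over `ℚ`, with `g^{4m} = 1` on `Gal(K/ℚ)`, and `Φ` ANY CM type.  Then

  `Rank(Φ) + b + 2·e₄ + Σ_{∅ ≠ D ⊆ primes(m)} (φ(2Π_D q)·s_{2,D} + φ(4Π_D q)·s_{4,D}) = [K:ℚ]/2 + 1`,

`b` = the imaginary quadratic subfields over which `Φ` is of Weil type, `e₄` = the CM subfields `F` with `Gal(F/ℚ) ≅ ℤ/4` every embedding of which has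
`[K:F]/2` extensions in `Φ` (Yanai), `s_{2,D}` (resp. `s_{4,D}`, with CYCLIC `Gal(F/ℚ)`) = the CM subfields of degree `2Π_D q` (resp. `4Π_D q`) over which
all `|D|`-th mixed differences of the multiplicities of `Φ|_F` vanish (families `σ_q`, `σ_q^q = 1`). [cite: Kubota1965, §4 Lemma 2]
[cite: Hazama2003CyclicCM, Prop. 4.3 and Thm. 4.8] [cite: Dodson1984, §3.1.1 Theorem] [cite: Yanai2015IndexDegeneracy, Thm. 4.1] [cite: LamLeung2000, Thm. 2.2]
[cite: Gordon1999HodgeAVSurvey, 9.4.3] -/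
theorem cmTypeRank_add_ncard_subfields_eq_of_exponent_four_mul (hm : Squarefree m) (hodd : ¬ 2 ∣ m)
    (hexp : ∀ g : K ≃ₐ[ℚ] K, g ^ (4 * m) = 1) (Φ : CMType K) :
    cmTypeRank Φ + {F : IntermediateField ℚ K | Module.finrank ℚ F = 2 ∧ ¬ IsTotallyReal F ∧
        ∀ τ : F →+* ℂ, {φ : K →+* ℂ | φ.comp (algebraMap F K) = τ ∧ φ ∈ Φ.1}.ncard =
          {φ : K →+* ℂ | φ.comp (algebraMap F K) = τ ∧ φ ∉ Φ.1}.ncard}.ncard +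
      2 * {F : IntermediateField ℚ K | Module.finrank ℚ F = 4 ∧ ¬ IsTotallyReal F ∧ IsCyclic (F ≃ₐ[ℚ] F) ∧
        ∀ τ : F →+* ℂ, 2 * {φ : K →+* ℂ | φ.comp (algebraMap F K) = τ ∧ φ ∈ Φ.1}.ncard = Module.finrank F K}.ncard +
      ∑ D ∈ m.primeFactors.powerset.filter (fun D => D.Nonempty),
        ((2 * ∏ q ∈ D, q).totient *
          {F : IntermediateField ℚ K | Module.finrank ℚ F = 2 * ∏ q ∈ D, q ∧ ¬ IsTotallyReal F ∧
            ∀ [IsAbelianGalois ℚ F] (σ : D → (F ≃ₐ[ℚ] F)), (∀ q : D, σ q ^ (q : ℕ) = 1) → ∀ τ : F →+* ℂ,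
              ∑ ε : D → Bool, (∏ q, (if ε q then (-1 : ℤ) else 1)) *
                ({φ : K →+* ℂ | φ.comp (algebraMap F K) = τ.comp (∏ q, (if ε q then σ q else 1)).toRingEquiv.toRingHom ∧
                  φ ∈ Φ.1}.ncard : ℤ) = 0}.ncard +
        (4 * ∏ q ∈ D, q).totient *
          {F : IntermediateField ℚ K | Module.finrank ℚ F = 4 * ∏ q ∈ D, q ∧ ¬ IsTotallyReal F ∧ IsCyclic (F ≃ₐ[ℚ] F) ∧
            ∀ [IsAbelianGalois ℚ F] (σ : D → (F ≃ₐ[ℚ] F)), (∀ q : D, σ q ^ (q : ℕ) = 1) → ∀ τ : F →+* ℂ,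
              ∑ ε : D → Bool, (∏ q, (if ε q then (-1 : ℤ) else 1)) *
                ({φ : K →+* ℂ | φ.comp (algebraMap F K) = τ.comp (∏ q, (if ε q then σ q else 1)).toRingEquiv.toRingHom ∧
                  φ ∈ Φ.1}.ncard : ℤ) = 0}.ncard) = Module.finrank ℚ K / 2 + 1 := by
  obtain ⟨φ₀⟩ := (inferInstance : Nonempty (K →+* ℂ))
  rw [← card_indexTwo_eq_ncard_weilQuadratic φ₀ Φ, ← card_indexFour_eq_ncard_weilQuartic φ₀ Φ,
    ← ExponentFourSquarefree.cmTypeRank_add_card_kernels_eq hm hodd φ₀ hexp Φ]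
  congr 1
  refine Finset.sum_congr rfl fun D _ => ?_
  rw [card_index_eq_ncard_mixed φ₀ Φ (fun q : D => (q : ℕ)) (2 * ∏ q ∈ D, q),
    card_index_isCyclic_eq_ncard_mixed φ₀ Φ (fun q : D => (q : ℕ)) (4 * ∏ q ∈ D, q)]

/-- **NONDEGENERACY CRITERION ON THE LATTICE OF SUBFIELDS (exponent `4m`, `m` odd squarefree).**  `Φ` is NONDEGENERATE iff (i) it is of Weil type over NO
imaginary quadratic subfield, (ii) «half of every fibre» over NO CM subfield with `Gal ≅ ℤ/4` (Yanai), and for every nonempty set `D` of prime divisors of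
`m` the `|D|`-th mixed differences of the multiplicities of `Φ|_F` vanish (iii) over NO CM subfield `F` of degree `2Π_D q` and (iv) over NO CM subfield `F`
of degree `4Π_D q` with cyclic `Gal(F/ℚ)`. [cite: Kubota1965, §4 Lemma 2] [cite: Hazama2003CyclicCM, Prop. 4.3 and Thm. 4.8] [cite: Dodson1984, §3.1.1 Theorem]
[cite: Yanai2015IndexDegeneracy, Thm. 4.1] -/
theorem isNondegenerate_iff_forall_intermediateField_of_exponent_four_mul (hm : Squarefree m) (hodd : ¬ 2 ∣ m)
    (hexp : ∀ g : K ≃ₐ[ℚ] K, g ^ (4 * m) = 1) (Φ : CMType K) :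
    IsNondegenerate Φ ↔
      (∀ F : IntermediateField ℚ K, Module.finrank ℚ F = 2 → ¬ IsTotallyReal F →
        ¬ ∀ τ : F →+* ℂ, {φ : K →+* ℂ | φ.comp (algebraMap F K) = τ ∧ φ ∈ Φ.1}.ncard =
          {φ : K →+* ℂ | φ.comp (algebraMap F K) = τ ∧ φ ∉ Φ.1}.ncard) ∧
      (∀ F : IntermediateField ℚ K, Module.finrank ℚ F = 4 → ¬ IsTotallyReal F → IsCyclic (F ≃ₐ[ℚ] F) →
        ¬ ∀ τ : F →+* ℂ, 2 * {φ : K →+* ℂ | φ.comp (algebraMap F K) = τ ∧ φ ∈ Φ.1}.ncard = Module.finrank F K) ∧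
      (∀ D ∈ m.primeFactors.powerset, D.Nonempty → ∀ F : IntermediateField ℚ K, Module.finrank ℚ F = 2 * ∏ q ∈ D, q →
        ¬ IsTotallyReal F → ∀ [IsAbelianGalois ℚ F],
        ¬ ∀ σ : D → (F ≃ₐ[ℚ] F), (∀ q : D, σ q ^ (q : ℕ) = 1) → ∀ τ : F →+* ℂ,
          ∑ ε : D → Bool, (∏ q, (if ε q then (-1 : ℤ) else 1)) *
            ({φ : K →+* ℂ | φ.comp (algebraMap F K) = τ.comp (∏ q, (if ε q then σ q else 1)).toRingEquiv.toRingHom ∧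
              φ ∈ Φ.1}.ncard : ℤ) = 0) ∧
      (∀ D ∈ m.primeFactors.powerset, D.Nonempty → ∀ F : IntermediateField ℚ K, Module.finrank ℚ F = 4 * ∏ q ∈ D, q →
        ¬ IsTotallyReal F → IsCyclic (F ≃ₐ[ℚ] F) → ∀ [IsAbelianGalois ℚ F],
        ¬ ∀ σ : D → (F ≃ₐ[ℚ] F), (∀ q : D, σ q ^ (q : ℕ) = 1) → ∀ τ : F →+* ℂ,
          ∑ ε : D → Bool, (∏ q, (if ε q then (-1 : ℤ) else 1)) *
            ({φ : K →+* ℂ | φ.comp (algebraMap F K) = τ.comp (∏ q, (if ε q then σ q else 1)).toRingEquiv.toRingHom ∧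
              φ ∈ Φ.1}.ncard : ℤ) = 0) := by
  obtain ⟨φ₀⟩ := (inferInstance : Nonempty (K →+* ℂ))
  rw [ExponentFourSquarefree.isNondegenerate_iff hm hodd φ₀ hexp Φ]
  refine and_congr_right fun _ => ?_
  refine and_congr ?_ (and_congr ?_ ?_)
  · constructor
    · intro h F h4 hF hcyc hQ
      exact h F.fixingSubgroup ((conjGal_not_mem_fixingSubgroup_iff F).2 hF)
        (by rw [CMNumbers.index_fixingSubgroup_eq_finrank, h4]) ((isCyclic_quotient_fixingSubgroup_iff F).2 hcyc)
        ((forall_two_mul_card_filter_eq_iff_forall_fibre φ₀ Φ F).2 hQ)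
    · intro h H hρH hidx hcyc hQ
      refine h (fixedField H) (by rw [← index_eq_finrank_fixedField, hidx])
        ((conjGal_not_mem_iff_not_isTotallyReal_fixedField H).1 hρH) ((isCyclic_quotient_iff_isCyclic_gal_fixedField H).1 hcyc)
        ((forall_two_mul_card_filter_eq_iff_forall_fibre φ₀ Φ (fixedField H)).1 ?_)
      simpa only [fixingSubgroup_fixedField] using hQ
  · refine forall_congr' fun D => forall_congr' fun _ => forall_congr' fun _ => ?_
    exact forall_subgroup_iff_forall_intermediateField_mixed φ₀ Φ (fun q : D => (q : ℕ)) (2 * ∏ q ∈ D, q)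
  · refine forall_congr' fun D => forall_congr' fun _ => forall_congr' fun _ => ?_
    exact forall_subgroup_isCyclic_iff_forall_intermediateField_mixed φ₀ Φ (fun q : D => (q : ℕ)) (4 * ∏ q ∈ D, q)

end FourMul

/-! ## §4 Consequences for abelian varieties: `B•(Aⁿ) ⊗ ℂ = D•(Aⁿ) ⊗ ℂ` and the Hodge conjecture for all powers, hypotheses on SUBFIELDS -/

section Varieties

open Literature.AlgebraicGeometry.Motives (AbelianVariety)
open Literature.AlgebraicGeometry.HodgeTheory
open Literature.AlgebraicGeometry.ComplexMultiplication (IsCMTypeRealisation)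
open Literature.AlgebraicGeometry.VanGeemen1994 (hodgeClassSpan)
open Literature.Barriers.HodgeConjecture (divisorClassesSpan)
open _root_.CategoryTheory _root_.CategoryTheory.Limits

variable {K : Type} [Field K] [NumberField K] [IsCMField K] [IsAbelianGalois ℚ K] {m : ℕ}
  {Φ : CMType K} {A : AbelianVariety ℂ} {ι : 𝓞 K →+* End A} {θ : K →+* Module.End ℂ (complexBetti A.X 1)}

/-- `Bᵐ ⊗ ℂ = Dᵐ ⊗ ℂ` for all `m` on an abelian variety gives the Hodge conjecture for it (Lefschetz `(1,1)`, cup products, tree theorems).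
[cite: Gordon1999HodgeAVSurvey, §9.3] -/
private theorem hodgeConjectureFor_of_forall_hodgeClassSpan_eq_md (B : AbelianVariety ℂ)
    (h : ∀ n : ℕ, hodgeClassSpan B.dim B.X n = divisorClassesSpan B.X B.dim n) : HodgeConjectureFor B.dim B.X :=
  ⟨nonempty_hodgeModel_holds (Motives.AbelianVariety.isSmoothProjective_holds (A := B)),
    fun n _ hc hmm ↦ AbelianVariety.divisorClassesSpan_le_algebraicClasses B
      (fun b hb hb' ↦ lefschetzOneOne_rational_holds (Motives.AbelianVariety.isSmoothProjective_holds (A := B)) b hb hb') n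
      ((h n) ▸ Submodule.subset_span ⟨hc, hmm⟩)⟩

/-- **`B•(Aⁿ) ⊗ ℂ = D•(Aⁿ) ⊗ ℂ` FOR EVERY REALISATION OF A TYPE OFF THE SUBFIELD LISTS (exponent `2m`, `m` odd squarefree)**: if `Φ` is of Weil type over
no imaginary quadratic subfield and, for every nonempty `D ⊆ primes(m)`, has non-vanishing `|D|`-th mixed differences over every CM subfield of degree
`2Π_D q`, then `Φ` is nondegenerate and all Hodge classes on all powers of every abelian variety of type `(K; Φ)` are generated by divisor classes
(Hazama's criterion ∕ Pohlmann; tree `IsNondegenerate.hodgeClassSpan_pow_eq_divisorClassesSpan`). [cite: Kubota1965, §4 Lemma 2]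
[cite: Gordon1999HodgeAVSurvey, Thm. 6.4 and §9.3] [cite: Hazama2003CyclicCM, Prop. 4.3 and Thm. 4.8] -/
theorem hodgeClassSpan_pow_eq_divisorClassesSpan_of_forall_intermediateField_of_exponent_two_mul (hm : Squarefree m) (hodd : ¬ 2 ∣ m)
    (hexp : ∀ g : K ≃ₐ[ℚ] K, g ^ (2 * m) = 1)
    (hW : ∀ F : IntermediateField ℚ K, Module.finrank ℚ F = 2 → ¬ IsTotallyReal F →
        ¬ ∀ τ : F →+* ℂ, {φ : K →+* ℂ | φ.comp (algebraMap F K) = τ ∧ φ ∈ Φ.1}.ncard =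
          {φ : K →+* ℂ | φ.comp (algebraMap F K) = τ ∧ φ ∉ Φ.1}.ncard)
    (hD : ∀ D ∈ m.primeFactors.powerset, D.Nonempty → ∀ F : IntermediateField ℚ K, Module.finrank ℚ F = 2 * ∏ q ∈ D, q →
        ¬ IsTotallyReal F → ∀ [IsAbelianGalois ℚ F],
        ¬ ∀ σ : D → (F ≃ₐ[ℚ] F), (∀ q : D, σ q ^ (q : ℕ) = 1) → ∀ τ : F →+* ℂ,
          ∑ ε : D → Bool, (∏ q, (if ε q then (-1 : ℤ) else 1)) *
            ({φ : K →+* ℂ | φ.comp (algebraMap F K) = τ.comp (∏ q, (if ε q then σ q else 1)).toRingEquiv.toRingHom ∧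
              φ ∈ Φ.1}.ncard : ℤ) = 0)
    (hA : IsCMTypeRealisation Φ A ι θ) (n k : ℕ) :
    hodgeClassSpan (⨁ fun _ : Fin n => A).dim (⨁ fun _ : Fin n => A).X k =
      divisorClassesSpan (⨁ fun _ : Fin n => A).X (⨁ fun _ : Fin n => A).dim k :=
  ((isNondegenerate_iff_forall_intermediateField_of_exponent_two_mul hm hodd hexp Φ).2 ⟨hW, hD⟩).hodgeClassSpan_pow_eq_divisorClassesSpan
    hA n k

/-- **THE HODGE CONJECTURE FOR ALL POWERS OF EVERY REALISATION OF A TYPE OFF THE SUBFIELD LISTS (exponent `2m`, `m` odd squarefree)** — UNCONDITIONAL,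
any realisation, hypotheses on the lattice of subfields only. [cite: Gordon1999HodgeAVSurvey, Thm. 6.4 and §9.3] [cite: Kubota1965, §4 Lemma 2]
[cite: Deligne2000, §1] -/
theorem hodgeConjectureFor_pow_of_forall_intermediateField_of_exponent_two_mul (hm : Squarefree m) (hodd : ¬ 2 ∣ m)
    (hexp : ∀ g : K ≃ₐ[ℚ] K, g ^ (2 * m) = 1)
    (hW : ∀ F : IntermediateField ℚ K, Module.finrank ℚ F = 2 → ¬ IsTotallyReal F →
        ¬ ∀ τ : F →+* ℂ, {φ : K →+* ℂ | φ.comp (algebraMap F K) = τ ∧ φ ∈ Φ.1}.ncard =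
          {φ : K →+* ℂ | φ.comp (algebraMap F K) = τ ∧ φ ∉ Φ.1}.ncard)
    (hD : ∀ D ∈ m.primeFactors.powerset, D.Nonempty → ∀ F : IntermediateField ℚ K, Module.finrank ℚ F = 2 * ∏ q ∈ D, q →
        ¬ IsTotallyReal F → ∀ [IsAbelianGalois ℚ F],
        ¬ ∀ σ : D → (F ≃ₐ[ℚ] F), (∀ q : D, σ q ^ (q : ℕ) = 1) → ∀ τ : F →+* ℂ,
          ∑ ε : D → Bool, (∏ q, (if ε q then (-1 : ℤ) else 1)) *
            ({φ : K →+* ℂ | φ.comp (algebraMap F K) = τ.comp (∏ q, (if ε q then σ q else 1)).toRingEquiv.toRingHom ∧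
              φ ∈ Φ.1}.ncard : ℤ) = 0)
    (hA : IsCMTypeRealisation Φ A ι θ) (n : ℕ) :
    HodgeConjectureFor (⨁ fun _ : Fin n => A).dim (⨁ fun _ : Fin n => A).X :=
  hodgeConjectureFor_of_forall_hodgeClassSpan_eq_md _
    fun k ↦ hodgeClassSpan_pow_eq_divisorClassesSpan_of_forall_intermediateField_of_exponent_two_mul hm hodd hexp hW hD hA n k

/-- **`B•(Aⁿ) ⊗ ℂ = D•(Aⁿ) ⊗ ℂ` FOR EVERY REALISATION OF A TYPE OFF THE SUBFIELD LISTS (exponent `4m`, `m` odd squarefree)** (Weil type over no imaginary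
quadratic subfield; «half of every fibre» over no cyclic quartic CM subfield; non-vanishing mixed differences over every CM subfield of degree `2Π_D q`, and
over every CM subfield of degree `4Π_D q` with cyclic Galois group). [cite: Kubota1965, §4 Lemma 2] [cite: Gordon1999HodgeAVSurvey, Thm. 6.4 and §9.3]
[cite: Hazama2003CyclicCM, Prop. 4.3 and Thm. 4.8] [cite: Yanai2015IndexDegeneracy, Thm. 4.1] -/
theorem hodgeClassSpan_pow_eq_divisorClassesSpan_of_forall_intermediateField_of_exponent_four_mul (hm : Squarefree m) (hodd : ¬ 2 ∣ m)
    (hexp : ∀ g : K ≃ₐ[ℚ] K, g ^ (4 * m) = 1)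
    (hW : ∀ F : IntermediateField ℚ K, Module.finrank ℚ F = 2 → ¬ IsTotallyReal F →
        ¬ ∀ τ : F →+* ℂ, {φ : K →+* ℂ | φ.comp (algebraMap F K) = τ ∧ φ ∈ Φ.1}.ncard =
          {φ : K →+* ℂ | φ.comp (algebraMap F K) = τ ∧ φ ∉ Φ.1}.ncard)
    (hQ : ∀ F : IntermediateField ℚ K, Module.finrank ℚ F = 4 → ¬ IsTotallyReal F → IsCyclic (F ≃ₐ[ℚ] F) →
        ¬ ∀ τ : F →+* ℂ, 2 * {φ : K →+* ℂ | φ.comp (algebraMap F K) = τ ∧ φ ∈ Φ.1}.ncard = Module.finrank F K)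
    (hD : ∀ D ∈ m.primeFactors.powerset, D.Nonempty → ∀ F : IntermediateField ℚ K, Module.finrank ℚ F = 2 * ∏ q ∈ D, q →
        ¬ IsTotallyReal F → ∀ [IsAbelianGalois ℚ F],
        ¬ ∀ σ : D → (F ≃ₐ[ℚ] F), (∀ q : D, σ q ^ (q : ℕ) = 1) → ∀ τ : F →+* ℂ,
          ∑ ε : D → Bool, (∏ q, (if ε q then (-1 : ℤ) else 1)) *
            ({φ : K →+* ℂ | φ.comp (algebraMap F K) = τ.comp (∏ q, (if ε q then σ q else 1)).toRingEquiv.toRingHom ∧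
              φ ∈ Φ.1}.ncard : ℤ) = 0)
    (hD4 : ∀ D ∈ m.primeFactors.powerset, D.Nonempty → ∀ F : IntermediateField ℚ K, Module.finrank ℚ F = 4 * ∏ q ∈ D, q →
        ¬ IsTotallyReal F → IsCyclic (F ≃ₐ[ℚ] F) → ∀ [IsAbelianGalois ℚ F],
        ¬ ∀ σ : D → (F ≃ₐ[ℚ] F), (∀ q : D, σ q ^ (q : ℕ) = 1) → ∀ τ : F →+* ℂ,
          ∑ ε : D → Bool, (∏ q, (if ε q then (-1 : ℤ) else 1)) *
            ({φ : K →+* ℂ | φ.comp (algebraMap F K) = τ.comp (∏ q, (if ε q then σ q else 1)).toRingEquiv.toRingHom ∧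
              φ ∈ Φ.1}.ncard : ℤ) = 0)
    (hA : IsCMTypeRealisation Φ A ι θ) (n k : ℕ) :
    hodgeClassSpan (⨁ fun _ : Fin n => A).dim (⨁ fun _ : Fin n => A).X k =
      divisorClassesSpan (⨁ fun _ : Fin n => A).X (⨁ fun _ : Fin n => A).dim k :=
  ((isNondegenerate_iff_forall_intermediateField_of_exponent_four_mul hm hodd hexp Φ).2
    ⟨hW, hQ, hD, hD4⟩).hodgeClassSpan_pow_eq_divisorClassesSpan hA n k

/-- **THE HODGE CONJECTURE FOR ALL POWERS OF EVERY REALISATION OF A TYPE OFF THE SUBFIELD LISTS (exponent `4m`, `m` odd squarefree)** — UNCONDITIONAL,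
any realisation, hypotheses on the lattice of subfields only. [cite: Gordon1999HodgeAVSurvey, Thm. 6.4 and §9.3] [cite: Kubota1965, §4 Lemma 2]
[cite: Deligne2000, §1] -/
theorem hodgeConjectureFor_pow_of_forall_intermediateField_of_exponent_four_mul (hm : Squarefree m) (hodd : ¬ 2 ∣ m)
    (hexp : ∀ g : K ≃ₐ[ℚ] K, g ^ (4 * m) = 1)
    (hW : ∀ F : IntermediateField ℚ K, Module.finrank ℚ F = 2 → ¬ IsTotallyReal F →
        ¬ ∀ τ : F →+* ℂ, {φ : K →+* ℂ | φ.comp (algebraMap F K) = τ ∧ φ ∈ Φ.1}.ncard =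
          {φ : K →+* ℂ | φ.comp (algebraMap F K) = τ ∧ φ ∉ Φ.1}.ncard)
    (hQ : ∀ F : IntermediateField ℚ K, Module.finrank ℚ F = 4 → ¬ IsTotallyReal F → IsCyclic (F ≃ₐ[ℚ] F) →
        ¬ ∀ τ : F →+* ℂ, 2 * {φ : K →+* ℂ | φ.comp (algebraMap F K) = τ ∧ φ ∈ Φ.1}.ncard = Module.finrank F K)
    (hD : ∀ D ∈ m.primeFactors.powerset, D.Nonempty → ∀ F : IntermediateField ℚ K, Module.finrank ℚ F = 2 * ∏ q ∈ D, q →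
        ¬ IsTotallyReal F → ∀ [IsAbelianGalois ℚ F],
        ¬ ∀ σ : D → (F ≃ₐ[ℚ] F), (∀ q : D, σ q ^ (q : ℕ) = 1) → ∀ τ : F →+* ℂ,
          ∑ ε : D → Bool, (∏ q, (if ε q then (-1 : ℤ) else 1)) *
            ({φ : K →+* ℂ | φ.comp (algebraMap F K) = τ.comp (∏ q, (if ε q then σ q else 1)).toRingEquiv.toRingHom ∧
              φ ∈ Φ.1}.ncard : ℤ) = 0)
    (hD4 : ∀ D ∈ m.primeFactors.powerset, D.Nonempty → ∀ F : IntermediateField ℚ K, Module.finrank ℚ F = 4 * ∏ q ∈ D, q →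
        ¬ IsTotallyReal F → IsCyclic (F ≃ₐ[ℚ] F) → ∀ [IsAbelianGalois ℚ F],
        ¬ ∀ σ : D → (F ≃ₐ[ℚ] F), (∀ q : D, σ q ^ (q : ℕ) = 1) → ∀ τ : F →+* ℂ,
          ∑ ε : D → Bool, (∏ q, (if ε q then (-1 : ℤ) else 1)) *
            ({φ : K →+* ℂ | φ.comp (algebraMap F K) = τ.comp (∏ q, (if ε q then σ q else 1)).toRingEquiv.toRingHom ∧
              φ ∈ Φ.1}.ncard : ℤ) = 0)
    (hA : IsCMTypeRealisation Φ A ι θ) (n : ℕ) :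
    HodgeConjectureFor (⨁ fun _ : Fin n => A).dim (⨁ fun _ : Fin n => A).X :=
  hodgeConjectureFor_of_forall_hodgeClassSpan_eq_md _
    fun k ↦ hodgeClassSpan_pow_eq_divisorClassesSpan_of_forall_intermediateField_of_exponent_four_mul hm hodd hexp hW hQ hD hD4 hA n k

end Varieties

/-! ## §5 The cyclotomic fields `ℚ(ζ_N)`: `u^{2m} = 1` resp. `u^{4m} = 1` on `(ℤ/N)ˣ`; the three-prime levels `ℚ(ζ₂₁₁)` and `ℚ(ζ₄₂₁)` on subfields -/

section Cyclotomic

open Literature.AlgebraicGeometry.Motives (AbelianVariety)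
open Literature.AlgebraicGeometry.HodgeTheory
open Literature.AlgebraicGeometry.ComplexMultiplication (IsCMTypeRealisation)
open _root_.CategoryTheory _root_.CategoryTheory.Limits

variable {N m : ℕ} {L : Type} [Field L] [NumberField L]
  {Φ : CMType L} {A : AbelianVariety ℂ} {ι : 𝓞 L →+* End A} {θ : L →+* Module.End ℂ (complexBetti A.X 1)}

/-- **The Hodge conjecture for all powers of every abelian variety with CM by `ℚ(ζ_N)`, `(ℤ/N)ˣ` of exponent dividing `2m` (`m` odd squarefree), whose
type is off the SUBFIELD lists** (Weil type over no imaginary quadratic subfield; non-vanishing mixed differences over every CM subfield of degree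
`2Π_D q`).  Instance hypotheses `[IsCMField L] [IsAbelianGalois ℚ L]` as in the neighbours (true for `ℚ(ζ_N)`, `N > 2`, tree
`cm_abelian_pow_eq_one_of_isCyclotomicExtension`). [cite: Gordon1999HodgeAVSurvey, Thm. 6.4 and §9.3] [cite: Washington1997, Ch. 2 Thm. 2.5] -/
theorem hodgeConjectureFor_pow_of_forall_intermediateField_of_isCyclotomicExtension_two_mul [NeZero N] [IsCyclotomicExtension {N} ℚ L]
    [IsCMField L] [IsAbelianGalois ℚ L] (h2N : 2 < N) (hm : Squarefree m) (hodd : ¬ 2 ∣ m) (hN : ∀ u : (ZMod N)ˣ, u ^ (2 * m) = 1)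
    (hW : ∀ F : IntermediateField ℚ L, Module.finrank ℚ F = 2 → ¬ IsTotallyReal F →
        ¬ ∀ τ : F →+* ℂ, {φ : L →+* ℂ | φ.comp (algebraMap F L) = τ ∧ φ ∈ Φ.1}.ncard =
          {φ : L →+* ℂ | φ.comp (algebraMap F L) = τ ∧ φ ∉ Φ.1}.ncard)
    (hD : ∀ D ∈ m.primeFactors.powerset, D.Nonempty → ∀ F : IntermediateField ℚ L, Module.finrank ℚ F = 2 * ∏ q ∈ D, q →
        ¬ IsTotallyReal F → ∀ [IsAbelianGalois ℚ F],
        ¬ ∀ σ : D → (F ≃ₐ[ℚ] F), (∀ q : D, σ q ^ (q : ℕ) = 1) → ∀ τ : F →+* ℂ,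
          ∑ ε : D → Bool, (∏ q, (if ε q then (-1 : ℤ) else 1)) *
            ({φ : L →+* ℂ | φ.comp (algebraMap F L) = τ.comp (∏ q, (if ε q then σ q else 1)).toRingEquiv.toRingHom ∧
              φ ∈ Φ.1}.ncard : ℤ) = 0)
    (hA : IsCMTypeRealisation Φ A ι θ) (n : ℕ) :
    HodgeConjectureFor (⨁ fun _ : Fin n => A).dim (⨁ fun _ : Fin n => A).X :=
  hodgeConjectureFor_pow_of_forall_intermediateField_of_exponent_two_mul hm hodd
    (cm_abelian_pow_eq_one_of_isCyclotomicExtension h2N hN L).2.2.1 hW hD hA n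

/-- **The same for `(ℤ/N)ˣ` of exponent dividing `4m`** (four subfield lists: Weil quadratic, Yanai cyclic quartic, degree `2Π_D q`, cyclic degree
`4Π_D q`). [cite: Gordon1999HodgeAVSurvey, Thm. 6.4 and §9.3] [cite: Washington1997, Ch. 2 Thm. 2.5] -/
theorem hodgeConjectureFor_pow_of_forall_intermediateField_of_isCyclotomicExtension_four_mul [NeZero N] [IsCyclotomicExtension {N} ℚ L]
    [IsCMField L] [IsAbelianGalois ℚ L] (h2N : 2 < N) (hm : Squarefree m) (hodd : ¬ 2 ∣ m) (hN : ∀ u : (ZMod N)ˣ, u ^ (4 * m) = 1)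
    (hW : ∀ F : IntermediateField ℚ L, Module.finrank ℚ F = 2 → ¬ IsTotallyReal F →
        ¬ ∀ τ : F →+* ℂ, {φ : L →+* ℂ | φ.comp (algebraMap F L) = τ ∧ φ ∈ Φ.1}.ncard =
          {φ : L →+* ℂ | φ.comp (algebraMap F L) = τ ∧ φ ∉ Φ.1}.ncard)
    (hQ : ∀ F : IntermediateField ℚ L, Module.finrank ℚ F = 4 → ¬ IsTotallyReal F → IsCyclic (F ≃ₐ[ℚ] F) →
        ¬ ∀ τ : F →+* ℂ, 2 * {φ : L →+* ℂ | φ.comp (algebraMap F L) = τ ∧ φ ∈ Φ.1}.ncard = Module.finrank F L)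
    (hD : ∀ D ∈ m.primeFactors.powerset, D.Nonempty → ∀ F : IntermediateField ℚ L, Module.finrank ℚ F = 2 * ∏ q ∈ D, q →
        ¬ IsTotallyReal F → ∀ [IsAbelianGalois ℚ F],
        ¬ ∀ σ : D → (F ≃ₐ[ℚ] F), (∀ q : D, σ q ^ (q : ℕ) = 1) → ∀ τ : F →+* ℂ,
          ∑ ε : D → Bool, (∏ q, (if ε q then (-1 : ℤ) else 1)) *
            ({φ : L →+* ℂ | φ.comp (algebraMap F L) = τ.comp (∏ q, (if ε q then σ q else 1)).toRingEquiv.toRingHom ∧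
              φ ∈ Φ.1}.ncard : ℤ) = 0)
    (hD4 : ∀ D ∈ m.primeFactors.powerset, D.Nonempty → ∀ F : IntermediateField ℚ L, Module.finrank ℚ F = 4 * ∏ q ∈ D, q →
        ¬ IsTotallyReal F → IsCyclic (F ≃ₐ[ℚ] F) → ∀ [IsAbelianGalois ℚ F],
        ¬ ∀ σ : D → (F ≃ₐ[ℚ] F), (∀ q : D, σ q ^ (q : ℕ) = 1) → ∀ τ : F →+* ℂ,
          ∑ ε : D → Bool, (∏ q, (if ε q then (-1 : ℤ) else 1)) *
            ({φ : L →+* ℂ | φ.comp (algebraMap F L) = τ.comp (∏ q, (if ε q then σ q else 1)).toRingEquiv.toRingHom ∧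
              φ ∈ Φ.1}.ncard : ℤ) = 0)
    (hA : IsCMTypeRealisation Φ A ι θ) (n : ℕ) :
    HodgeConjectureFor (⨁ fun _ : Fin n => A).dim (⨁ fun _ : Fin n => A).X :=
  hodgeConjectureFor_pow_of_forall_intermediateField_of_exponent_four_mul hm hodd
    (cm_abelian_pow_eq_one_of_isCyclotomicExtension h2N hN L).2.2.1 hW hQ hD hD4 hA n

/-- `105 = 3·5·7` is squarefree. [folklore] -/
private theorem squarefree_oneHundredFive_md : Squarefree (105 : ℕ) := by
  rw [show (105 : ℕ) = 3 * (5 * 7) by norm_num, Nat.squarefree_mul_iff, Nat.squarefree_mul_iff]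
  exact ⟨by norm_num, Nat.prime_three.prime.squarefree, by norm_num, Nat.prime_five.prime.squarefree, (by norm_num : Nat.Prime 7).prime.squarefree⟩

/-- **`ℚ(ζ₂₁₁)` ON SUBFIELDS: THE HODGE CONJECTURE FOR ALL POWERS of every abelian variety with complex multiplication by `ℚ(ζ₂₁₁)` (CM `105`-folds;
`Gal ≅ ℤ/210`, `210 = 2·3·5·7`) whose type is of Weil type over none of the imaginary quadratic subfields and has non-vanishing `|D|`-th mixed differences
over every CM subfield of degree `2Π_{q∈D} q`, `∅ ≠ D ⊆ {3, 5, 7}`** (degrees `6, 10, 14, 30, 42, 70, 210`; `ℚ(ζ₂₁₁)` being cyclic, each degree carries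
exactly one CM subfield) — UNCONDITIONAL. [cite: Gordon1999HodgeAVSurvey, Thm. 6.4 and §9.3] [cite: Kubota1965, §4 Lemma 2] [cite: Washington1997, Ch. 2 Thm. 2.5] -/
theorem hodgeConjectureFor_pow_of_forall_intermediateField_twoHundredEleven [IsCyclotomicExtension {211} ℚ L] [IsCMField L] [IsAbelianGalois ℚ L]
    (hW : ∀ F : IntermediateField ℚ L, Module.finrank ℚ F = 2 → ¬ IsTotallyReal F →
        ¬ ∀ τ : F →+* ℂ, {φ : L →+* ℂ | φ.comp (algebraMap F L) = τ ∧ φ ∈ Φ.1}.ncard =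
          {φ : L →+* ℂ | φ.comp (algebraMap F L) = τ ∧ φ ∉ Φ.1}.ncard)
    (hD : ∀ D ∈ (105 : ℕ).primeFactors.powerset, D.Nonempty → ∀ F : IntermediateField ℚ L, Module.finrank ℚ F = 2 * ∏ q ∈ D, q →
        ¬ IsTotallyReal F → ∀ [IsAbelianGalois ℚ F],
        ¬ ∀ σ : D → (F ≃ₐ[ℚ] F), (∀ q : D, σ q ^ (q : ℕ) = 1) → ∀ τ : F →+* ℂ,
          ∑ ε : D → Bool, (∏ q, (if ε q then (-1 : ℤ) else 1)) *
            ({φ : L →+* ℂ | φ.comp (algebraMap F L) = τ.comp (∏ q, (if ε q then σ q else 1)).toRingEquiv.toRingHom ∧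
              φ ∈ Φ.1}.ncard : ℤ) = 0)
    (hA : IsCMTypeRealisation Φ A ι θ) (n : ℕ) :
    HodgeConjectureFor (⨁ fun _ : Fin n => A).dim (⨁ fun _ : Fin n => A).X :=
  haveI : NeZero (211 : ℕ) := ⟨by norm_num⟩
  hodgeConjectureFor_pow_of_forall_intermediateField_of_isCyclotomicExtension_two_mul (N := 211) (by norm_num) squarefree_oneHundredFive_md
    (by norm_num) ExponentTwiceSquarefree.units_pow_twoHundredTen_twoHundredEleven hW hD hA n

/-- **`ℚ(ζ₄₂₁)` ON SUBFIELDS: THE HODGE CONJECTURE FOR ALL POWERS of every abelian variety with complex multiplication by `ℚ(ζ₄₂₁)` (CM `210`-folds;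
`Gal ≅ ℤ/420`, `420 = 4·3·5·7`) whose type is off the four subfield lists** (Weil type over no imaginary quadratic subfield; not «half of every fibre»
over the cyclic quartic CM subfield; non-vanishing `|D|`-th mixed differences over every CM subfield of degree `2Π_D q` and `4Π_D q`, `∅ ≠ D ⊆ {3,5,7}`)
— UNCONDITIONAL. [cite: Gordon1999HodgeAVSurvey, Thm. 6.4 and §9.3] [cite: Kubota1965, §4 Lemma 2] [cite: Washington1997, Ch. 2 Thm. 2.5] -/
theorem hodgeConjectureFor_pow_of_forall_intermediateField_fourHundredTwentyOne [IsCyclotomicExtension {421} ℚ L] [IsCMField L]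
    [IsAbelianGalois ℚ L]
    (hW : ∀ F : IntermediateField ℚ L, Module.finrank ℚ F = 2 → ¬ IsTotallyReal F →
        ¬ ∀ τ : F →+* ℂ, {φ : L →+* ℂ | φ.comp (algebraMap F L) = τ ∧ φ ∈ Φ.1}.ncard =
          {φ : L →+* ℂ | φ.comp (algebraMap F L) = τ ∧ φ ∉ Φ.1}.ncard)
    (hQ : ∀ F : IntermediateField ℚ L, Module.finrank ℚ F = 4 → ¬ IsTotallyReal F → IsCyclic (F ≃ₐ[ℚ] F) →
        ¬ ∀ τ : F →+* ℂ, 2 * {φ : L →+* ℂ | φ.comp (algebraMap F L) = τ ∧ φ ∈ Φ.1}.ncard = Module.finrank F L)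
    (hD : ∀ D ∈ (105 : ℕ).primeFactors.powerset, D.Nonempty → ∀ F : IntermediateField ℚ L, Module.finrank ℚ F = 2 * ∏ q ∈ D, q →
        ¬ IsTotallyReal F → ∀ [IsAbelianGalois ℚ F],
        ¬ ∀ σ : D → (F ≃ₐ[ℚ] F), (∀ q : D, σ q ^ (q : ℕ) = 1) → ∀ τ : F →+* ℂ,
          ∑ ε : D → Bool, (∏ q, (if ε q then (-1 : ℤ) else 1)) *
            ({φ : L →+* ℂ | φ.comp (algebraMap F L) = τ.comp (∏ q, (if ε q then σ q else 1)).toRingEquiv.toRingHom ∧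
              φ ∈ Φ.1}.ncard : ℤ) = 0)
    (hD4 : ∀ D ∈ (105 : ℕ).primeFactors.powerset, D.Nonempty → ∀ F : IntermediateField ℚ L, Module.finrank ℚ F = 4 * ∏ q ∈ D, q →
        ¬ IsTotallyReal F → IsCyclic (F ≃ₐ[ℚ] F) → ∀ [IsAbelianGalois ℚ F],
        ¬ ∀ σ : D → (F ≃ₐ[ℚ] F), (∀ q : D, σ q ^ (q : ℕ) = 1) → ∀ τ : F →+* ℂ,
          ∑ ε : D → Bool, (∏ q, (if ε q then (-1 : ℤ) else 1)) *
            ({φ : L →+* ℂ | φ.comp (algebraMap F L) = τ.comp (∏ q, (if ε q then σ q else 1)).toRingEquiv.toRingHom ∧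
              φ ∈ Φ.1}.ncard : ℤ) = 0)
    (hA : IsCMTypeRealisation Φ A ι θ) (n : ℕ) :
    HodgeConjectureFor (⨁ fun _ : Fin n => A).dim (⨁ fun _ : Fin n => A).X :=
  haveI : NeZero (421 : ℕ) := ⟨by norm_num⟩
  hodgeConjectureFor_pow_of_forall_intermediateField_of_isCyclotomicExtension_four_mul (N := 421) (by norm_num) squarefree_oneHundredFive_md
    (by norm_num) ExponentFourSquarefree.units_pow_fourHundredTwenty_fourHundredTwentyOne hW hQ hD hD4 hA n

end Cyclotomic

end MixedDifferencesReading

end Literature.AlgebraicGeometry.Pohlmann1968
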